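/-
Copyright (c) 2026 the pub-hodgecm-mathlib formalisation cell (harness21).  Prover seat hodgecm-mathlib-LH4-p13 (g8), req620 Track A «(D-RAM) FOUR-FRAME» squad, tier 0,
STAGE-1b PRE-SCOPING (heir LEAD F0P3a-plan (g20) T19-24∕T19-31 (R-29)(b) «T₊ DERIVED if the set identity ★-lands»; dealer LH4-plan (g12) WORD #45∕#47; F0P3-p01 (g35)
TEMPLATE-LAWS §2 (α) + PRECISION 10:05:48Z): organ (L-lab) «THE LABEL LAW» — brick (L-lab-8) «THE SKEW-LINE CRITERION»: the TRACE HALF of the set identity (α), K-wide —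
for a unitary `u = 1 + X` every hermitian value `⟨y, Xy⟩` satisfies `⟨y,Xy⟩ + σ⟨y,Xy⟩ = −⟨Xy,Xy⟩`, so it lies `ϖ^m`-near the skew line iff the HERMITIAN SQUARE `⟨Xy,Xy⟩` is
deep; at a fixed vertex the square is bounded by the level of `X·X`.  2026-09-04.
-/
import Summits.HodgeConjecture.HodgeConjecture.Theorems.F0P3cDyRamHeisenbergShellValueSet   -- ★ p859171 (this seat, (L-lab-6)): brings ★ (L-lab-3) `valueSetMod_smul_xPlus`, ★ №3 Pieces, ★ U2G DEFS (via (L-lab-0)),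
                                                                                            -- ★ `pairing_comm_of_hermitian`, ★ `map_antidiagonal_three_over_apply_eq`, ★ `pairing_mulVec_mulVec`, ★ `WildQuadraticDatumTrace`, ★ `map_refSkewScalar_eq_neg`
import Literature.NumberTheory.Automorphic.UnitaryLatticeTreeTypes                         -- ★ `le_dualLatt_of_isVertexLattice`, `mem_scaleLattice_iff` (brings ★ T1a DEFS `mapGL`, `dualLatt`, `scaleLattice`, `IsVertexLattice`)
import HarnessLib

/-!
# Crux `H413`, line LH4 «(D-RAM) FOUR-FRAME», tier 0, STAGE-1b pre-scoping — (L-lab-8) «THE SKEW-LINE CRITERION»: for unitary `1 + X`, a hermitian value `⟨y, Xy⟩` is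
# `ϖ^m`-close to the skew line iff its hermitian square `⟨Xy, Xy⟩` is deep (the trace half of the set identity (α) «clean shell = square level `m_c`», K-wide)

Cell `hodgecm-mathlib` (D-0151), FLOOR 0, crux item H413 = `stmt-HodgeConjecture-24833`, route of record `HCCMUnconditional`; squad F0∕P3c∕LH4.  SCOPING INVENTORY for the
STAGE-1b directive (heir LEAD T19-31 (R-29)(b): row `stub_rows_transvPlus` becomes DERIVED by ★ p858649 linearity once F0P3-p01 (g35)'s set identity
«`shell ∧ (LabelPlus ∨ LabelMinus′) = shell ∧ (X·X deep to level m_c)`, `m_c = 2⌊(m*+d)∕2⌋`» ★-lands; TEMPLATE-LAWS 0e5ec958 §2∕§3 (α), PRECISION 10:05:48Z «state (α) with the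
HERMITIAN criterion»).  THEOREMS ONLY (no `def`, no instance, no notation, no `sorry`, default heartbeats), ★-only imports, lane `--supports stmt-HodgeConjecture-24833 --as helper`;
pays NO row, states NO law.

THE MATHEMATICS.  `Φ₃ = antidiag(1,1,1)`, `σ` an involution, `g ∈ U(σ, Φ₃)`, `X := g − 1`.  ISOMETRY `⟨gy, gy⟩ = ⟨y, y⟩` expands, with hermitian symmetry `⟨Xy, y⟩ = σ⟨y, Xy⟩`, to
  **`⟨y, Xy⟩ + σ⟨y, Xy⟩ = −⟨Xy, Xy⟩`**   (§1 `pairing_add_map_pairing_eq_neg_sq`; «`X + X* = −X*X`»).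
So the TRACE of a hermitian value is minus a hermitian SQUARE, and over a ramified quadratic datum `(σ, ϖ, d, t)` (trace images `Tr 𝔭_E^m = 𝔭_F^{⌊(m+d)∕2⌋}`, ★ `WildQuadraticDatumTrace`):
a value `a` with `a + σa = −s` is `ϖ^m`-close to a SKEW element iff (essentially) `v_E(s) ≥ 2⌊(m+d)∕2⌋ =: m_c` (§2: `2n ≤ j + 1`, `m + d ≤ 2n + 1` from `|s| ≤ exp(−j)`, resp. no skew
`ϖ^m`-close once `|s| > exp(−2n)`, `2n ≤ m + d`).  At a vertex `M` of the tree (any type: `M ≤ M^♯`) fixed by `g`, the square is controlled by the LEVEL OF `X·X`: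
`⟨Xy, Xy⟩ = −⟨g⁻¹·X·X·y, y⟩` (isometry again), so `X·X·M ⊆ ϖ^j·M ⇒ |⟨Xy, Xy⟩| ≤ |ϖ|^j` for every `y ∈ M` (§3).  Hence (§4): **if `X·X·M ⊆ ϖ^j M` with `j ≥ m_c − 1`, every value
`⟨y, Xy⟩`, `y ∈ M`, is `ϖ^m`-close to the skew line** (the CLEAN side of (α) — what remains for «LabelPlus ∨ LabelMinus′» is that the on-line value set is ONE reference set
`e·t₊·N(𝒪)`, i.e. principal: ★ (L-lab-1)∕(L-lab-2) on one-slot strata, ★ (L-lab-6) on `N`), and **if some `y ∈ M` (resp. some integral `y`) has a SHALLOW square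
`|⟨Xy, Xy⟩| > exp(−2n)`, `2n ≤ m + d`, then `latticeValueSetMod σ ϖ m M X` (resp. `valueSetMod σ ϖ m X`) differs from `valueSetMod σ ϖ m (e • X₊)` for EVERY `σ`-fixed `e`** —
no `LabelPlus`, no «LabelMinus′», the engine's class 'X' (the UNCLEAN side of (α), K-wide and unconditional).  F0P3-p01's precision: the exact criterion is hermitian
(«all squares `⟨Xy,Xy⟩ ∈ 𝔭_F^{⌊(m*+d)∕2⌋}`»); the square LEVEL `m_c` is sufficient (§3) and, by the different, necessary only up to `d` off the diagonal — on `N` and on every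
type-(1) fixed vertex read so far the two agree (odd layers empty).

* §1 `mulVec_coe_sub_one` (`X y = g y − y`), **`pairing_add_map_pairing_eq_neg_sq`** (the trace identity), `map_pairing_self` (`⟨w, w⟩` is `σ`-fixed).
* §2 `exists_skew_near_of_trace_deep`, `not_v_sub_skew_le_of_trace_shallow` (abstract: `a + σa = −s`).
* §3 `mulVec_mem_of_mapGL_eq`, `pairing_sq_eq_neg_pairing_inv_sq` (`⟨Xy, Xy⟩ = −⟨g⁻¹X²y, y⟩`), **`v_pairing_sq_le_of_latticeInLevel_sq`** (`X²M ⊆ ϖ^jM ⇒ |⟨Xy,Xy⟩| ≤ |ϖ|^j` on `M`).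
* §4 HEADS: **`forall_exists_skew_near_of_latticeInLevel_sq`** (clean side at a fixed vertex), **`latticeValueSetMod_ne_smul_xPlus_of_sq_shallow`** ∕ `not_latticeLabelPlus_of_sq_shallow`
  (unclean side at a lattice), **`valueSetMod_ne_smul_xPlus_of_sq_shallow`** ∕ `not_labelPlus_of_sq_shallow` (unclean side on `𝒪³`, the ★ №3 piece predicate `LabelPlus σ ϖ d m X`).
HONEST LABEL.  Count-neutral scoping brick; the three tier-0 rows stay OPEN; the PRINCIPALITY half of (α) on glued strata, the (β) census statements and the (γ) level rows are NOT
here; `HC_CM` is proved only modulo the 7 printed citations (2 remaining named inputs: hLiu418 = `stmt-HodgeConjecture-24832`, h413 = `stmt-HodgeConjecture-24833`) until rung 0 closes.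

## References
* [Rogawski1990] J. D. Rogawski, *Automorphic Representations of Unitary Groups in Three Variables*, Ann. of Math. Stud. 123 (1990), §4.9 Prop. 4.9.1 (b) p. 55 (the two
  transvection classes read through hermitian values), §1.10 p. 9 (`X + X* = −X*X` on the Heisenberg group).
* [Serre1979] J.-P. Serre, *Local Fields*, GTM 67 (1979), Ch. III §3 Prop. 7 (trace images and the different).
* [Jacobowitz1962] R. Jacobowitz, *Hermitian forms over local fields*, Amer. J. Math. 84 (1962), §4 (hermitian lattices, duals, values).
* [Kottwitz1986BaseChangeUnits] R. E. Kottwitz, *Base change for unit elements of Hecke algebras*, Compositio Math. 60 (1986), §1 pp. 240–241 (congruence-level pieces as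
  lattice conditions).
-/

set_option autoImplicit false

noncomputable section

namespace Summit.HodgeConjecture.HodgeConjecture.Cruxes.H413.F0P3cDyRamValueSetSkewLineCriterion

open Literature.NumberTheory.Automorphic Literature.NumberTheory.Automorphic.HermitianLattice
open Literature.NumberTheory.Automorphic.UnitaryLatticeTree Literature.NumberTheory.Automorphic.UnitaryThreeFourFrame
open Literature.NumberTheory.LocalFields Literature.NumberTheory.LocalFields.WildQuadraticDatum
open Summit.HodgeConjecture.HodgeConjecture.Cruxes.H413.F0P3cDyRamFourFramePieces
open Summit.HodgeConjecture.HodgeConjecture.Cruxes.H413.F0P3cDyRamFourFrameCensusDefs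
open Summit.HodgeConjecture.HodgeConjecture.Cruxes.H413.F0P3cDyRamShellLabelPlus (v_inv_varpi_pow_mul_le_one_iff)
open Summit.HodgeConjecture.HodgeConjecture.Cruxes.H413.F0P3cDyRamSmulXPlusLabel (valueSetMod_smul_xPlus)
open scoped Matrix MatrixGroups Valued
open WithZero

variable {K : Type} [Field K] [Valued K ℤᵐ⁰]

/-! ## §1  The trace identity `⟨y, Xy⟩ + σ⟨y, Xy⟩ = −⟨Xy, Xy⟩` for unitary `1 + X` -/

omit [Valued K ℤᵐ⁰] in
/-- `X·y = g·y − y` for `X = g − 1`. [cite: Kottwitz1986BaseChangeUnits, §1 pp. 240–241] -/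
theorem mulVec_coe_sub_one (g : GL (Fin 3) K) (y : Fin 3 → K) :
    ((g : Matrix (Fin 3) (Fin 3) K) - 1) *ᵥ y = (g : Matrix (Fin 3) (Fin 3) K) *ᵥ y - y := by
  rw [Matrix.sub_mulVec, Matrix.one_mulVec]

omit [Valued K ℤᵐ⁰] in
/-- **THE TRACE IDENTITY** («`X + X* = −X*X`»).  For an involution `σ`, `g ∈ U(σ, Φ₃)` and `X = g − 1`: `⟨y, Xy⟩ + σ⟨y, Xy⟩ = −⟨Xy, Xy⟩` for every `y` — expand the isometry
`⟨gy, gy⟩ = ⟨y, y⟩` at `gy = y + Xy` and use hermitian symmetry `⟨Xy, y⟩ = σ⟨y, Xy⟩`. [cite: Rogawski1990, §1.10 p. 9] [cite: Jacobowitz1962, §4] -/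
theorem pairing_add_map_pairing_eq_neg_sq {σ : K →+* K} (hσσ : ∀ a, σ (σ a) = a) {g : GL (Fin 3) K}
    (hg : g ∈ unitaryGroupOfForm σ ((StdForm.antidiagonal 3).over K)) (y : Fin 3 → K) :
    pairing σ ((StdForm.antidiagonal 3).over K) y (((g : Matrix (Fin 3) (Fin 3) K) - 1) *ᵥ y) +
        σ (pairing σ ((StdForm.antidiagonal 3).over K) y (((g : Matrix (Fin 3) (Fin 3) K) - 1) *ᵥ y)) =
      - pairing σ ((StdForm.antidiagonal 3).over K) (((g : Matrix (Fin 3) (Fin 3) K) - 1) *ᵥ y) (((g : Matrix (Fin 3) (Fin 3) K) - 1) *ᵥ y) := by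
  have hH := map_antidiagonal_three_over_apply_eq (K := K) σ
  have hg' : formCongr σ g ((StdForm.antidiagonal 3).over K) = (StdForm.antidiagonal 3).over K := hg
  -- isometry at `y`
  have hiso : pairing σ ((StdForm.antidiagonal 3).over K) ((g : Matrix (Fin 3) (Fin 3) K) *ᵥ y) ((g : Matrix (Fin 3) (Fin 3) K) *ᵥ y) =
      pairing σ ((StdForm.antidiagonal 3).over K) y y := by
    rw [pairing_mulVec_mulVec, hg']
  have hgy : (g : Matrix (Fin 3) (Fin 3) K) *ᵥ y = y + ((g : Matrix (Fin 3) (Fin 3) K) - 1) *ᵥ y := by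
    rw [mulVec_coe_sub_one, add_sub_cancel]
  rw [hgy, LinearMap.map_add₂, map_add, map_add, pairing_comm_of_hermitian hσσ hH y (((g : Matrix (Fin 3) (Fin 3) K) - 1) *ᵥ y)] at hiso
  linear_combination hiso

omit [Valued K ℤᵐ⁰] in
/-- A hermitian square `⟨w, w⟩_{Φ₃}` is `σ`-fixed. [cite: Jacobowitz1962, §4] -/
theorem map_pairing_self {σ : K →+* K} (hσσ : ∀ a, σ (σ a) = a) (w : Fin 3 → K) :
    σ (pairing σ ((StdForm.antidiagonal 3).over K) w w) = pairing σ ((StdForm.antidiagonal 3).over K) w w :=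
  (pairing_comm_of_hermitian hσσ (map_antidiagonal_three_over_apply_eq (K := K) σ) w w).symm

/-! ## §2  A value with deep (resp. shallow) trace is near (resp. far from) the skew line -/

/-- **DEEP TRACE ⇒ NEAR THE SKEW LINE.**  Ramified quadratic datum (`σ` an involution whose fixed elements have even valuation, `|ϖ| = exp(−1)`, `|ϖ − σϖ| = |ϖ|^d`,
`|2| = |ϖ|^t`).  If `a + σa = −s` with `|s| ≤ exp(−j)`, and `2n ≤ j + 1`, `m + d ≤ 2n + 1`, then `a` is `ϖ^m`-close to a skew element (`s` is `σ`-fixed of even valuation `≤ −2n`,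
so `−s ∈ 𝔭_F^{n} ⊆ Tr 𝔭_E^m`, ★ `exists_v_le_add_map_eq`; subtract the preimage). [cite: Serre1979, Ch. III §3 Prop. 7] -/
theorem exists_skew_near_of_trace_deep {σ : K →+* K} {ϖ : K} {d t : ℕ} (hσ : ∀ x, σ (σ x) = x)
    (hfix : ∀ x : K, σ x = x → x ≠ 0 → ∃ n : ℤ, Valued.v x = exp (2 * n))
    (hϖ : Valued.v ϖ = exp (-1 : ℤ)) (hd : Valued.v (ϖ - σ ϖ) = Valued.v ϖ ^ d) (ht : Valued.v (2 : K) = Valued.v ϖ ^ t)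
    {a s : K} (has : a + σ a = -s) {j n : ℤ} {m : ℕ} (hvs : Valued.v s ≤ exp (-j)) (hjn : 2 * n ≤ j + 1) (hmn : (m : ℤ) + d ≤ 2 * n + 1) :
    ∃ z' : K, σ z' = -z' ∧ Valued.v ((ϖ ^ m)⁻¹ * (a - z')) ≤ 1 := by
  have hsfix : σ s = s := by
    have h := congrArg σ has
    rw [map_add, hσ, map_neg, add_comm] at h
    rw [has] at h
    exact neg_injective h.symm
  have hyfix : σ (-s) = -s := by rw [map_neg, hsfix]
  have hvy : Valued.v (-s) ≤ exp (-(2 * n)) := by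
    rw [Valuation.map_neg]
    rcases eq_or_ne s 0 with rfl | hs0
    · rw [map_zero]; exact zero_le
    obtain ⟨p, hp⟩ := hfix s hsfix hs0
    rw [hp, exp_le_exp] at hvs ⊢
    omega
  obtain ⟨b, hb, hbb⟩ := exists_v_le_add_map_eq hσ hfix hϖ hd ht hyfix (j := m) (m := n) hvy hmn
  refine ⟨a - b, ?_, ?_⟩
  · have h1 : σ a = -s - a := by linear_combination has
    have h2 : σ b = -s - b := by linear_combination hbb
    rw [map_sub, h1, h2]; ring
  · rw [sub_sub_cancel, v_inv_varpi_pow_mul_le_one_iff hϖ]; exact hb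

/-- **SHALLOW TRACE ⇒ FAR FROM THE SKEW LINE.**  If `a + σa = −s` with `|s| > exp(−2n)` and `2n ≤ m + d`, then NO skew `z′` is `ϖ^m`-close to `a` — else
`−s = Tr(a − z′) ∈ Tr 𝔭_E^m ⊆ 𝔭_F^{⌊(m+d)∕2⌋}` (★ `v_add_map_le_exp`). [cite: Serre1979, Ch. III §3 Prop. 7] -/
theorem not_v_sub_skew_le_of_trace_shallow {σ : K →+* K} {ϖ : K} {d t : ℕ} (hσ : ∀ x, σ (σ x) = x)
    (hfix : ∀ x : K, σ x = x → x ≠ 0 → ∃ n : ℤ, Valued.v x = exp (2 * n))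
    (hϖ : Valued.v ϖ = exp (-1 : ℤ)) (hd : Valued.v (ϖ - σ ϖ) = Valued.v ϖ ^ d) (ht : Valued.v (2 : K) = Valued.v ϖ ^ t)
    {a s : K} (has : a + σ a = -s) {n : ℤ} {m : ℕ} (hn : 2 * n ≤ (m : ℤ) + d) (hs : exp (-(2 * n)) < Valued.v s)
    {z' : K} (hσz' : σ z' = -z') : ¬ Valued.v ((ϖ ^ m)⁻¹ * (a - z')) ≤ 1 := by
  intro h
  rw [v_inv_varpi_pow_mul_le_one_iff hϖ] at h
  have htr : (a - z') + σ (a - z') = -s := by rw [map_sub, hσz']; linear_combination has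
  have key := v_add_map_le_exp hσ hfix hϖ hd ht h hn
  rw [htr, Valuation.map_neg] at key
  exact not_le.2 hs key

/-! ## §3  At a fixed vertex the hermitian square is bounded by the level of `X·X` -/

/-- `T·M = M ⇒ T·x ∈ M` for `x ∈ M`. [cite: Kottwitz1986BaseChangeUnits, §1 pp. 240–241] -/
theorem mulVec_mem_of_mapGL_eq {T : GL (Fin 3) K} {M : Submodule 𝒪[K] (Fin 3 → K)} (hT : mapGL T M = M) {x : Fin 3 → K} (hx : x ∈ M) :
    (T : Matrix (Fin 3) (Fin 3) K) *ᵥ x ∈ M := by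
  have h1 : ((Matrix.toLin' (T : Matrix (Fin 3) (Fin 3) K)).restrictScalars 𝒪[K]) x ∈ mapGL T M := Submodule.mem_map_of_mem hx
  rw [hT, LinearMap.restrictScalars_apply, Matrix.toLin'_apply] at h1
  exact h1

omit [Valued K ℤᵐ⁰] in
/-- **THE SQUARE THROUGH `X·X`**: for `g ∈ U(σ, Φ₃)`, `X = g − 1` and every `y`: `⟨Xy, Xy⟩ = −⟨g⁻¹·(X·X·y), y⟩` (`⟨Xy, gy⟩ = ⟨g⁻¹Xy, y⟩` by isometry, and
`(g⁻¹ − 1)·X = −g⁻¹·X·X`). [cite: Rogawski1990, §1.10 p. 9] [cite: Jacobowitz1962, §4] -/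
theorem pairing_sq_eq_neg_pairing_inv_sq (σ : K →+* K) {g : GL (Fin 3) K} (hg : g ∈ unitaryGroupOfForm σ ((StdForm.antidiagonal 3).over K)) (y : Fin 3 → K) :
    pairing σ ((StdForm.antidiagonal 3).over K) (((g : Matrix (Fin 3) (Fin 3) K) - 1) *ᵥ y) (((g : Matrix (Fin 3) (Fin 3) K) - 1) *ᵥ y) =
      - pairing σ ((StdForm.antidiagonal 3).over K)
          (((g⁻¹ : GL (Fin 3) K) : Matrix (Fin 3) (Fin 3) K) *ᵥ ((((g : Matrix (Fin 3) (Fin 3) K) - 1) * ((g : Matrix (Fin 3) (Fin 3) K) - 1)) *ᵥ y)) y := by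
  have hg' : formCongr σ g ((StdForm.antidiagonal 3).over K) = (StdForm.antidiagonal 3).over K := hg
  have hginv : (g : Matrix (Fin 3) (Fin 3) K) * ((g⁻¹ : GL (Fin 3) K) : Matrix (Fin 3) (Fin 3) K) = 1 := by
    rw [← Units.val_mul, mul_inv_cancel, Units.val_one]
  have hinvg : ((g⁻¹ : GL (Fin 3) K) : Matrix (Fin 3) (Fin 3) K) * (g : Matrix (Fin 3) (Fin 3) K) = 1 := by
    rw [← Units.val_mul, inv_mul_cancel, Units.val_one]
  -- isometry: `⟨w, g y⟩ = ⟨g (g⁻¹ w), g y⟩ = ⟨g⁻¹ w, y⟩`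
  have key : ∀ w : Fin 3 → K, pairing σ ((StdForm.antidiagonal 3).over K) w ((g : Matrix (Fin 3) (Fin 3) K) *ᵥ y) =
      pairing σ ((StdForm.antidiagonal 3).over K) (((g⁻¹ : GL (Fin 3) K) : Matrix (Fin 3) (Fin 3) K) *ᵥ w) y := by
    intro w
    have e : w = (g : Matrix (Fin 3) (Fin 3) K) *ᵥ (((g⁻¹ : GL (Fin 3) K) : Matrix (Fin 3) (Fin 3) K) *ᵥ w) := by
      rw [Matrix.mulVec_mulVec, hginv, Matrix.one_mulVec]
    conv_lhs => rw [e]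
    rw [pairing_mulVec_mulVec, hg']
  -- `⟨Xy, Xy⟩ = ⟨Xy, g y⟩ − ⟨Xy, y⟩ = ⟨g⁻¹(Xy) − Xy, y⟩`
  have hA : pairing σ ((StdForm.antidiagonal 3).over K) (((g : Matrix (Fin 3) (Fin 3) K) - 1) *ᵥ y) (((g : Matrix (Fin 3) (Fin 3) K) - 1) *ᵥ y) =
      pairing σ ((StdForm.antidiagonal 3).over K) (((g : Matrix (Fin 3) (Fin 3) K) - 1) *ᵥ y) ((g : Matrix (Fin 3) (Fin 3) K) *ᵥ y) -
        pairing σ ((StdForm.antidiagonal 3).over K) (((g : Matrix (Fin 3) (Fin 3) K) - 1) *ᵥ y) y := by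
    rw [← map_sub, ← mulVec_coe_sub_one]
  have hC : pairing σ ((StdForm.antidiagonal 3).over K) (((g : Matrix (Fin 3) (Fin 3) K) - 1) *ᵥ y) (((g : Matrix (Fin 3) (Fin 3) K) - 1) *ᵥ y) =
      pairing σ ((StdForm.antidiagonal 3).over K)
        ((((g⁻¹ : GL (Fin 3) K) : Matrix (Fin 3) (Fin 3) K) *ᵥ (((g : Matrix (Fin 3) (Fin 3) K) - 1) *ᵥ y)) - ((g : Matrix (Fin 3) (Fin 3) K) - 1) *ᵥ y) y := by
    rw [hA, key, LinearMap.map_sub₂]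
  -- `g⁻¹·(X·X·y) = X y − g⁻¹(X y)` (`g⁻¹·X = 1 − g⁻¹`)
  have hD : ((g⁻¹ : GL (Fin 3) K) : Matrix (Fin 3) (Fin 3) K) *ᵥ ((((g : Matrix (Fin 3) (Fin 3) K) - 1) * ((g : Matrix (Fin 3) (Fin 3) K) - 1)) *ᵥ y) =
      ((g : Matrix (Fin 3) (Fin 3) K) - 1) *ᵥ y - ((g⁻¹ : GL (Fin 3) K) : Matrix (Fin 3) (Fin 3) K) *ᵥ (((g : Matrix (Fin 3) (Fin 3) K) - 1) *ᵥ y) := by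
    have hm : ((g⁻¹ : GL (Fin 3) K) : Matrix (Fin 3) (Fin 3) K) * (((g : Matrix (Fin 3) (Fin 3) K) - 1) * ((g : Matrix (Fin 3) (Fin 3) K) - 1)) =
        ((g : Matrix (Fin 3) (Fin 3) K) - 1) - ((g⁻¹ : GL (Fin 3) K) : Matrix (Fin 3) (Fin 3) K) * ((g : Matrix (Fin 3) (Fin 3) K) - 1) := by
      have hgX : ((g⁻¹ : GL (Fin 3) K) : Matrix (Fin 3) (Fin 3) K) * ((g : Matrix (Fin 3) (Fin 3) K) - 1) = 1 - ((g⁻¹ : GL (Fin 3) K) : Matrix (Fin 3) (Fin 3) K) := by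
        rw [Matrix.mul_sub, hinvg, Matrix.mul_one]
      rw [← Matrix.mul_assoc, hgX, Matrix.sub_mul, Matrix.one_mul, hgX]
    rw [Matrix.mulVec_mulVec, hm, Matrix.sub_mulVec, Matrix.mulVec_mulVec]
  rw [hC, hD, ← LinearMap.map_neg₂, neg_sub]

/-- **`X·X·M ⊆ ϖ^j·M ⇒ |⟨Xy, Xy⟩| ≤ |ϖ|^j` ON `M`.**  For `σ` isometric, `g ∈ U(σ, Φ₃)` fixing a vertex `M` (any type: `M ≤ M^♯`) and `X = g − 1`: if `LatticeInLevel ϖ j (X·X) M` then every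
`y ∈ M` has `|⟨Xy, Xy⟩| ≤ |ϖ|^j` (§3 `⟨Xy,Xy⟩ = −⟨g⁻¹X²y, y⟩` with `g⁻¹X²y ∈ ϖ^j·M` and `⟨M, M⟩ ⊆ 𝒪`).
[cite: Kottwitz1986BaseChangeUnits, §1 pp. 240–241] [cite: Jacobowitz1962, §4] -/
theorem v_pairing_sq_le_of_latticeInLevel_sq {σ : K →+* K} (hvσ : ∀ a, Valued.v (σ a) = Valued.v a) {ϖ : K} (hϖ0 : ϖ ≠ 0)
    {g : GL (Fin 3) K} (hg : g ∈ unitaryGroupOfForm σ ((StdForm.antidiagonal 3).over K))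
    {M : Submodule 𝒪[K] (Fin 3 → K)} {t : ℕ} (hM : IsVertexLattice σ ϖ ((StdForm.antidiagonal 3).over K) t M) (hfix : mapGL g M = M)
    {j : ℕ} (hlev : LatticeInLevel ϖ j (((g : Matrix (Fin 3) (Fin 3) K) - 1) * ((g : Matrix (Fin 3) (Fin 3) K) - 1)) M)
    {y : Fin 3 → K} (hy : y ∈ M) :
    Valued.v (pairing σ ((StdForm.antidiagonal 3).over K) (((g : Matrix (Fin 3) (Fin 3) K) - 1) *ᵥ y) (((g : Matrix (Fin 3) (Fin 3) K) - 1) *ᵥ y)) ≤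
      Valued.v ϖ ^ j := by
  have hc : (ϖ ^ j : K) ≠ 0 := pow_ne_zero j hϖ0
  -- `(X·X) y ∈ ϖ^j M`, i.e. `m₀ := (ϖ^j)⁻¹ • (X·X) y ∈ M`
  have hXXy : ((((g : Matrix (Fin 3) (Fin 3) K) - 1) * ((g : Matrix (Fin 3) (Fin 3) K) - 1)) *ᵥ y) ∈ scaleLattice (ϖ ^ j) M := by
    have h := hlev (Submodule.mem_map_of_mem (f := (Matrix.toLin' ((((g : Matrix (Fin 3) (Fin 3) K) - 1) * ((g : Matrix (Fin 3) (Fin 3) K) - 1)))).restrictScalars 𝒪[K]) hy)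
    rwa [LinearMap.restrictScalars_apply, Matrix.toLin'_apply] at h
  rw [mem_scaleLattice_iff hc] at hXXy
  -- `g⁻¹` stabilises `M`
  have hfix' : mapGL g⁻¹ M = M := by
    conv_lhs => rw [← hfix]
    exact mapGL_inv_mapGL g M
  have hm₁ : ((g⁻¹ : GL (Fin 3) K) : Matrix (Fin 3) (Fin 3) K) *ᵥ ((ϖ ^ j)⁻¹ • ((((g : Matrix (Fin 3) (Fin 3) K) - 1) * ((g : Matrix (Fin 3) (Fin 3) K) - 1)) *ᵥ y)) ∈ M :=
    mulVec_mem_of_mapGL_eq hfix' hXXy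
  -- integrality of the pairing on `M × M`
  have hint : Valued.v (pairing σ ((StdForm.antidiagonal 3).over K)
      (((g⁻¹ : GL (Fin 3) K) : Matrix (Fin 3) (Fin 3) K) *ᵥ ((ϖ ^ j)⁻¹ • ((((g : Matrix (Fin 3) (Fin 3) K) - 1) * ((g : Matrix (Fin 3) (Fin 3) K) - 1)) *ᵥ y))) y) ≤ 1 :=
    (mem_dualLatt σ _ M y).1 (le_dualLatt_of_isVertexLattice hvσ hM hy) _ hm₁
  -- assemble: `⟨Xy,Xy⟩ = −σ(ϖ^j)·⟨g⁻¹ m₀, y⟩`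
  have hsmul : ((g⁻¹ : GL (Fin 3) K) : Matrix (Fin 3) (Fin 3) K) *ᵥ ((((g : Matrix (Fin 3) (Fin 3) K) - 1) * ((g : Matrix (Fin 3) (Fin 3) K) - 1)) *ᵥ y) =
      (ϖ ^ j) • (((g⁻¹ : GL (Fin 3) K) : Matrix (Fin 3) (Fin 3) K) *ᵥ ((ϖ ^ j)⁻¹ • ((((g : Matrix (Fin 3) (Fin 3) K) - 1) * ((g : Matrix (Fin 3) (Fin 3) K) - 1)) *ᵥ y))) := by
    rw [Matrix.mulVec_smul, smul_smul, mul_inv_cancel₀ hc, one_smul]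
  rw [pairing_sq_eq_neg_pairing_inv_sq σ hg, Valuation.map_neg, hsmul, LinearMap.map_smulₛₗ₂, smul_eq_mul, map_mul, hvσ, map_pow]
  calc Valued.v ϖ ^ j * _ ≤ Valued.v ϖ ^ j * 1 := mul_le_mul' le_rfl hint
    _ = Valued.v ϖ ^ j := mul_one _

/-! ## §4  Heads: the clean side at a fixed vertex; the unclean side at a lattice and on `𝒪³` -/

/-- **CLEAN SIDE OF (α) AT A FIXED VERTEX.**  Ramified quadratic datum (`σ` an involutive isometry, even fixed valuations, `|ϖ| = exp(−1)`, `|ϖ − σϖ| = |ϖ|^d`, `|2| = |ϖ|^t`);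
`g ∈ U(σ, Φ₃)` fixing a vertex `M` (any type), `X = g − 1`, `X·X·M ⊆ ϖ^j·M`; integers with `2n ≤ j + 1` and `m + d ≤ 2n + 1` (e.g. `j = m_c = 2⌊(m+d)∕2⌋`, or `j = m_c − 1`).  Then EVERY
hermitian value `⟨y, Xy⟩`, `y ∈ M`, is `ϖ^m`-close to a SKEW element — the whole value set of `X` on `M` sits on the skew line modulo `ϖ^m`.
[cite: Serre1979, Ch. III §3 Prop. 7] [cite: Rogawski1990, §4.9 Prop. 4.9.1 (b) p. 55] [cite: Kottwitz1986BaseChangeUnits, §1 pp. 240–241] -/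
theorem forall_exists_skew_near_of_latticeInLevel_sq {σ : K →+* K} {ϖ : K} {d t : ℕ} (hσ : ∀ x, σ (σ x) = x) (hvσ : ∀ a, Valued.v (σ a) = Valued.v a)
    (hfix : ∀ x : K, σ x = x → x ≠ 0 → ∃ n : ℤ, Valued.v x = exp (2 * n))
    (hϖ : Valued.v ϖ = exp (-1 : ℤ)) (hd : Valued.v (ϖ - σ ϖ) = Valued.v ϖ ^ d) (ht : Valued.v (2 : K) = Valued.v ϖ ^ t)
    {g : GL (Fin 3) K} (hg : g ∈ unitaryGroupOfForm σ ((StdForm.antidiagonal 3).over K))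
    {M : Submodule 𝒪[K] (Fin 3 → K)} {tM : ℕ} (hM : IsVertexLattice σ ϖ ((StdForm.antidiagonal 3).over K) tM M) (hgM : mapGL g M = M)
    {j : ℕ} (hlev : LatticeInLevel ϖ j (((g : Matrix (Fin 3) (Fin 3) K) - 1) * ((g : Matrix (Fin 3) (Fin 3) K) - 1)) M)
    {n : ℤ} {m : ℕ} (hjn : 2 * n ≤ (j : ℤ) + 1) (hmn : (m : ℤ) + d ≤ 2 * n + 1) :
    ∀ y ∈ M, ∃ z' : K, σ z' = -z' ∧
      Valued.v ((ϖ ^ m)⁻¹ * (pairing σ ((StdForm.antidiagonal 3).over K) y (((g : Matrix (Fin 3) (Fin 3) K) - 1) *ᵥ y) - z')) ≤ 1 := by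
  intro y hy
  have hϖ0 : ϖ ≠ 0 := fun h => by rw [h, map_zero] at hϖ; exact exp_ne_zero hϖ.symm
  have hsq := v_pairing_sq_le_of_latticeInLevel_sq hvσ hϖ0 hg hM hgM hlev hy
  rw [v_varpi_pow hϖ] at hsq
  exact exists_skew_near_of_trace_deep hσ hfix hϖ hd ht (pairing_add_map_pairing_eq_neg_sq hσ hg y) hsq hjn hmn

/-- **UNCLEAN SIDE OF (α) AT A LATTICE.**  Ramified quadratic datum, `g ∈ U(σ, Φ₃)`, `X = g − 1`; if some `y ∈ M` has a SHALLOW hermitian square `|⟨Xy, Xy⟩| > exp(−2n)` with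
`2n ≤ m + d`, then for every `σ`-fixed `e`: `latticeValueSetMod σ ϖ m M X ≠ valueSetMod σ ϖ m (e • xPlus σ ϖ d)` — the value `⟨y, Xy⟩` is far from the skew line, while every
value `e·t₊·N(a)` of `e • X₊` is skew.  So NO transvection class at all (neither `+` nor any «LabelMinus′»).
[cite: Rogawski1990, §4.9 Prop. 4.9.1 (b) p. 55] [cite: Serre1979, Ch. III §3 Prop. 7] -/
theorem latticeValueSetMod_ne_smul_xPlus_of_sq_shallow {σ : K →+* K} {ϖ : K} {d t : ℕ} (hσ : ∀ x, σ (σ x) = x)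
    (hfix : ∀ x : K, σ x = x → x ≠ 0 → ∃ n : ℤ, Valued.v x = exp (2 * n))
    (hϖ : Valued.v ϖ = exp (-1 : ℤ)) (hd : Valued.v (ϖ - σ ϖ) = Valued.v ϖ ^ d) (ht : Valued.v (2 : K) = Valued.v ϖ ^ t)
    {g : GL (Fin 3) K} (hg : g ∈ unitaryGroupOfForm σ ((StdForm.antidiagonal 3).over K))
    {M : Submodule 𝒪[K] (Fin 3 → K)} {y : Fin 3 → K} (hy : y ∈ M) {n : ℤ} {m : ℕ} (hn : 2 * n ≤ (m : ℤ) + d)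
    (hs : exp (-(2 * n)) < Valued.v (pairing σ ((StdForm.antidiagonal 3).over K) (((g : Matrix (Fin 3) (Fin 3) K) - 1) *ᵥ y) (((g : Matrix (Fin 3) (Fin 3) K) - 1) *ᵥ y)))
    {e : K} (hσe : σ e = e) :
    latticeValueSetMod σ ϖ m M ((g : Matrix (Fin 3) (Fin 3) K) - 1) ≠ valueSetMod σ ϖ m (e • xPlus σ ϖ d) := by
  intro hEq
  have hmem : pairing σ ((StdForm.antidiagonal 3).over K) y (((g : Matrix (Fin 3) (Fin 3) K) - 1) *ᵥ y) ∈
      latticeValueSetMod σ ϖ m M ((g : Matrix (Fin 3) (Fin 3) K) - 1) :=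
    ⟨y, hy, by rw [sub_self, mul_zero, map_zero]; exact zero_le_one⟩
  rw [hEq, valueSetMod_smul_xPlus] at hmem
  obtain ⟨a, -, ha⟩ := hmem
  refine not_v_sub_skew_le_of_trace_shallow hσ hfix hϖ hd ht (pairing_add_map_pairing_eq_neg_sq hσ hg y) hn hs ?_ ha
  rw [map_mul, map_mul, hσe, map_refSkewScalar_eq_neg hσ, map_mul, hσ, mul_comm (σ a) a]
  ring

/-- Hence **no `LatticeLabelPlus`** at such a vertex (`e = 1`). [cite: Rogawski1990, §4.9 Prop. 4.9.1 (b) p. 55] -/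
theorem not_latticeLabelPlus_of_sq_shallow {σ : K →+* K} {ϖ : K} {d t : ℕ} (hσ : ∀ x, σ (σ x) = x)
    (hfix : ∀ x : K, σ x = x → x ≠ 0 → ∃ n : ℤ, Valued.v x = exp (2 * n))
    (hϖ : Valued.v ϖ = exp (-1 : ℤ)) (hd : Valued.v (ϖ - σ ϖ) = Valued.v ϖ ^ d) (ht : Valued.v (2 : K) = Valued.v ϖ ^ t)
    {g : GL (Fin 3) K} (hg : g ∈ unitaryGroupOfForm σ ((StdForm.antidiagonal 3).over K))
    {M : Submodule 𝒪[K] (Fin 3 → K)} {y : Fin 3 → K} (hy : y ∈ M) {n : ℤ} {m : ℕ} (hn : 2 * n ≤ (m : ℤ) + d)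
    (hs : exp (-(2 * n)) < Valued.v (pairing σ ((StdForm.antidiagonal 3).over K) (((g : Matrix (Fin 3) (Fin 3) K) - 1) *ᵥ y) (((g : Matrix (Fin 3) (Fin 3) K) - 1) *ᵥ y))) :
    ¬ LatticeLabelPlus σ ϖ d m M ((g : Matrix (Fin 3) (Fin 3) K) - 1) := by
  intro hL
  refine latticeValueSetMod_ne_smul_xPlus_of_sq_shallow hσ hfix hϖ hd ht hg hy hn hs (map_one σ) ?_
  rw [one_smul]
  exact hL

/-- **UNCLEAN SIDE OF (α) ON `𝒪³`** (the ★ №3 piece predicate).  Ramified quadratic datum, `g ∈ U(σ, Φ₃)`, `X = g − 1`; if some INTEGRAL `y` has `|⟨Xy, Xy⟩| > exp(−2n)` with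
`2n ≤ m + d`, then for every `σ`-fixed `e`: `valueSetMod σ ϖ m X ≠ valueSetMod σ ϖ m (e • xPlus σ ϖ d)`. [cite: Rogawski1990, §4.9 Prop. 4.9.1 (b) p. 55] [cite: Serre1979, Ch. III §3 Prop. 7] -/
theorem valueSetMod_ne_smul_xPlus_of_sq_shallow {σ : K →+* K} {ϖ : K} {d t : ℕ} (hσ : ∀ x, σ (σ x) = x)
    (hfix : ∀ x : K, σ x = x → x ≠ 0 → ∃ n : ℤ, Valued.v x = exp (2 * n))
    (hϖ : Valued.v ϖ = exp (-1 : ℤ)) (hd : Valued.v (ϖ - σ ϖ) = Valued.v ϖ ^ d) (ht : Valued.v (2 : K) = Valued.v ϖ ^ t)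
    {g : GL (Fin 3) K} (hg : g ∈ unitaryGroupOfForm σ ((StdForm.antidiagonal 3).over K))
    {y : Fin 3 → K} (hy : ∀ i, Valued.v (y i) ≤ 1) {n : ℤ} {m : ℕ} (hn : 2 * n ≤ (m : ℤ) + d)
    (hs : exp (-(2 * n)) < Valued.v (pairing σ ((StdForm.antidiagonal 3).over K) (((g : Matrix (Fin 3) (Fin 3) K) - 1) *ᵥ y) (((g : Matrix (Fin 3) (Fin 3) K) - 1) *ᵥ y)))
    {e : K} (hσe : σ e = e) :
    valueSetMod σ ϖ m ((g : Matrix (Fin 3) (Fin 3) K) - 1) ≠ valueSetMod σ ϖ m (e • xPlus σ ϖ d) := by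
  intro hEq
  have hmem : pairing σ ((StdForm.antidiagonal 3).over K) y (((g : Matrix (Fin 3) (Fin 3) K) - 1) *ᵥ y) ∈
      valueSetMod σ ϖ m ((g : Matrix (Fin 3) (Fin 3) K) - 1) :=
    ⟨y, hy, by rw [sub_self, mul_zero, map_zero]; exact zero_le_one⟩
  rw [hEq, valueSetMod_smul_xPlus] at hmem
  obtain ⟨a, -, ha⟩ := hmem
  refine not_v_sub_skew_le_of_trace_shallow hσ hfix hϖ hd ht (pairing_add_map_pairing_eq_neg_sq hσ hg y) hn hs ?_ ha
  rw [map_mul, map_mul, hσe, map_refSkewScalar_eq_neg hσ, map_mul, hσ, mul_comm (σ a) a]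
  ring

/-- Hence **no `LabelPlus σ ϖ d m X`** for such an `X = g − 1` (`e = 1`): the element is in NO transvection class at level `m` (engine class 'X' ⊆ Lean `pieceTransvMinus`).
[cite: Rogawski1990, §4.9 Prop. 4.9.1 (b) p. 55] -/
theorem not_labelPlus_of_sq_shallow {σ : K →+* K} {ϖ : K} {d t : ℕ} (hσ : ∀ x, σ (σ x) = x)
    (hfix : ∀ x : K, σ x = x → x ≠ 0 → ∃ n : ℤ, Valued.v x = exp (2 * n))
    (hϖ : Valued.v ϖ = exp (-1 : ℤ)) (hd : Valued.v (ϖ - σ ϖ) = Valued.v ϖ ^ d) (ht : Valued.v (2 : K) = Valued.v ϖ ^ t)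
    {g : GL (Fin 3) K} (hg : g ∈ unitaryGroupOfForm σ ((StdForm.antidiagonal 3).over K))
    {y : Fin 3 → K} (hy : ∀ i, Valued.v (y i) ≤ 1) {n : ℤ} {m : ℕ} (hn : 2 * n ≤ (m : ℤ) + d)
    (hs : exp (-(2 * n)) < Valued.v (pairing σ ((StdForm.antidiagonal 3).over K) (((g : Matrix (Fin 3) (Fin 3) K) - 1) *ᵥ y) (((g : Matrix (Fin 3) (Fin 3) K) - 1) *ᵥ y))) :
    ¬ LabelPlus σ ϖ d m ((g : Matrix (Fin 3) (Fin 3) K) - 1) := by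
  intro hL
  refine valueSetMod_ne_smul_xPlus_of_sq_shallow hσ hfix hϖ hd ht hg hy hn hs (map_one σ) ?_
  rw [one_smul]
  exact hL

end Summit.HodgeConjecture.HodgeConjecture.Cruxes.H413.F0P3cDyRamValueSetSkewLineCriterion

end
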